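import Summits.RiemannHypothesis.RiemannHypothesis.Theorems.WeilFormatCWindowSesq
import Summits.RiemannHypothesis.RiemannHypothesis.Theorems.WeilFormatCWindowSectors
import HarnessLib

/-!
# Format C (Fourier–Galerkin certificates of Weil positivity): the Gram expansion of the window form
  on finite families, and on Yoshida's trigonometric windows

Helper file (`--supports stmt-RiemannHypothesis-0098`, lead-track anchor), RH-free. Seat
rh-explicit-weil-3 (gen3). Sequel of `WeilFormatCWindowSesq.lean` (sesquilinear window form
`weilWindowSesq`, hermitian, linear in the first argument) and `WeilFormatCWindowSectors.lean`
(trigonometric windows are window functions).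

## Contents (sorry-free)

* `weilWindowSesq_sum_left / _sum_right`: finite linear combinations in either argument;
* **the Gram expansion** `weilWindowForm_sum_smul`: for window functions `u_i` and coefficients `c`,
  `weilWindowForm b (Σ_i c_i u_i) = Σ_i Σ_j c_i conj(c_j) · weilWindowSesq b u_i u_j` (as complex
  numbers; the left side is real);
* `isWindowFunction_chi`: Yoshida's `χ_n = (2a)^{-1/2} e^{iπnx/a} 𝟙_{[-a,a]}` is a window function;
* **the format-C interface** `weilWindowForm_sum_smul_chi`:
  `weilWindowForm a (Σ_{|n|≤N} c_n χ_n) = Σ_m Σ_n c_m conj(c_n) G(m, n)` with the GRAM MATRIX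
  `G(m, n) := weilWindowSesq a (chi a m) (chi a n)` — so a certificate proving
  `0 ≤ Re Σ c_m conj(c_n) G(m,n)` for all `N`, `c` (from closed forms for `G`, Yoshida 1992
  (5.13)–(5.16), = item L-C1) feeds `weilPositivityOn_of_weilWindowForm_sum_chi_nonneg`
  (`WeilFormatCWindowDictionary.lean`) and yields `WeilPositivityOn a`
  (`weilPositivityOn_of_gram_nonneg` below);
* **real certificates suffice** (`weilPositivityOn_of_real_gram_psd`, `…_real_gram_sector_psd`):
  when the Gram entries are real (they are: Yoshida's closed forms), non-negativity of the REAL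
  quadratic form `Σ x_m x_n Re G(m,n)` on real (resp. even real / odd real) vectors — the output of an
  exact `LDLᵀ` or interval-PSD check — already gives `WeilPositivityOn a`.
-/

set_option autoImplicit false
set_option linter.dupNamespace false  -- the mandated namespace repeats `RiemannHypothesis`

noncomputable section

open Complex Filter Set MeasureTheory
open scoped Real Topology ComplexConjugate

namespace Summit.RiemannHypothesis.RiemannHypothesis.Theorems.WeilFormatC

open Literature.NumberTheory.LFunctions
open Literature.NumberTheory.LFunctions.Yoshida1992 (modes chi chiCore)

variable {a : ℝ}

/-! ## Finite linear combinations -/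

/-- Linearity of the sesquilinear window form in the first argument over finite sums of window
functions (`a ≥ 0`). -/
theorem weilWindowSesq_sum_left (ha : 0 ≤ a) {ι : Type*} (s : Finset ι) {u : ι → ℝ → ℂ}
    (hu : ∀ i ∈ s, IsWindowFunction a (u i)) {v : ℝ → ℂ} (hv : IsWindowFunction a v) (c : ι → ℂ)
    (b : ℝ) :
    weilWindowSesq b (∑ i ∈ s, c i • u i) v = ∑ i ∈ s, c i * weilWindowSesq b (u i) v := by
  classical
  induction s using Finset.induction_on with
  | empty =>
    simp only [Finset.sum_empty]
    have h := weilWindowSesq_smul_left b 0 (0 : ℝ → ℂ) v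
    rw [zero_mul, zero_smul] at h
    exact h
  | insert i s hi ih =>
    rw [Finset.sum_insert hi, Finset.sum_insert hi,
      weilWindowSesq_add_left ha ((hu i (Finset.mem_insert_self i s)).smul (c i))
        (IsWindowFunction.sum s c fun j hj ↦ hu j (Finset.mem_insert_of_mem hj)) hv,
      weilWindowSesq_smul_left, ih fun j hj ↦ hu j (Finset.mem_insert_of_mem hj)]

/-- Conjugate-linearity of the sesquilinear window form in the second argument over finite sums of
window functions (`a ≥ 0`; from `weilWindowSesq_sum_left` and hermitian symmetry). -/
theorem weilWindowSesq_sum_right (ha : 0 ≤ a) {ι : Type*} (s : Finset ι) {v : ι → ℝ → ℂ}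
    (hv : ∀ j ∈ s, IsWindowFunction a (v j)) {u : ℝ → ℂ} (hu : IsWindowFunction a u) (c : ι → ℂ)
    (b : ℝ) :
    weilWindowSesq b u (∑ j ∈ s, c j • v j) = ∑ j ∈ s, conj (c j) * weilWindowSesq b u (v j) := by
  rw [weilWindowSesq_conj_symm, weilWindowSesq_sum_left ha s hv hu c b, map_sum]
  refine Finset.sum_congr rfl fun j _ ↦ ?_
  rw [map_mul, ← weilWindowSesq_conj_symm]

/-- **The Gram expansion of the window form.** For window functions `u_i` (`a ≥ 0`) and
coefficients `c`,
`weilWindowForm b (Σ_i c_i u_i) = Σ_i Σ_j c_i conj(c_j) weilWindowSesq b u_i u_j` (in `ℂ`). -/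
theorem weilWindowForm_sum_smul (ha : 0 ≤ a) {ι : Type*} (s : Finset ι) {u : ι → ℝ → ℂ}
    (hu : ∀ i ∈ s, IsWindowFunction a (u i)) (c : ι → ℂ) (b : ℝ) :
    (weilWindowForm b (∑ i ∈ s, c i • u i) : ℂ) =
      ∑ i ∈ s, ∑ j ∈ s, c i * conj (c j) * weilWindowSesq b (u i) (u j) := by
  rw [← weilWindowSesq_self, weilWindowSesq_sum_left ha s hu (IsWindowFunction.sum s c hu) c b]
  refine Finset.sum_congr rfl fun i hi ↦ ?_
  rw [weilWindowSesq_sum_right ha s hu (hu i hi) c b, Finset.mul_sum]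
  exact Finset.sum_congr rfl fun j _ ↦ by ring

/-- Real-part form of the Gram expansion: `weilWindowForm b (Σ c_i u_i) = Re Σ Σ c_i conj(c_j) W(u_i,u_j)`. -/
theorem weilWindowForm_sum_smul_eq_re (ha : 0 ≤ a) {ι : Type*} (s : Finset ι) {u : ι → ℝ → ℂ}
    (hu : ∀ i ∈ s, IsWindowFunction a (u i)) (c : ι → ℂ) (b : ℝ) :
    weilWindowForm b (∑ i ∈ s, c i • u i) =
      (∑ i ∈ s, ∑ j ∈ s, c i * conj (c j) * weilWindowSesq b (u i) (u j)).re := by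
  rw [← weilWindowForm_sum_smul ha s hu c b, Complex.ofReal_re]

/-! ## Yoshida's trigonometric windows -/

/-- `χ_n` is a window function (`a > 0`): measurable, `0` off `[-a,a]`, `‖χ_n‖ ≤ (2a)^{-1/2}`,
Lipschitz with constant `(2a)^{-1/2} π|n|/a` on the closed window. -/
theorem isWindowFunction_chi (ha : 0 < a) (n : ℤ) : IsWindowFunction a (chi a n) := by
  refine ⟨measurable_chi a n, fun x hx ↦ ?_, ⟨1 / Real.sqrt (2 * a), fun x ↦ norm_chi_le a n x⟩,
    ⟨1 / Real.sqrt (2 * a) * (π * |(n : ℝ)| / a), fun x y hx hy ↦ norm_chi_sub_le ha n hx hy⟩⟩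
  rw [chi, Set.indicator_of_notMem hx (chiCore a n)]

/-- **The format-C interface.** For `a > 0`, every `N` and all coefficients `c : ℤ → ℂ`,
`weilWindowForm a (Σ_{|n| ≤ N} c_n χ_n) = Σ_m Σ_n c_m conj(c_n) G(m, n)` with the Gram matrix
`G(m, n) = weilWindowSesq a (chi a m) (chi a n)` (hermitian by `weilWindowSesq_conj_symm`). -/
theorem weilWindowForm_sum_smul_chi (ha : 0 < a) (N : ℕ) (c : ℤ → ℂ) :
    (weilWindowForm a (∑ n ∈ modes N, c n • chi a n) : ℂ) =
      ∑ m ∈ modes N, ∑ n ∈ modes N, c m * conj (c n) * weilWindowSesq a (chi a m) (chi a n) :=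
  weilWindowForm_sum_smul ha.le (modes N) (fun n _ ↦ isWindowFunction_chi ha n) c a

/-- **From a Gram certificate to a rung.** If for every `N` and every coefficient vector the
hermitian form of the Gram matrix `G(m,n) = weilWindowSesq a χ_m χ_n` has non-negative real part,
`0 ≤ Re Σ_{m,n} c_m conj(c_n) G(m,n)`, then `WeilPositivityOn a` (`a > 0`). This is the statement a
Fourier–Galerkin certificate (dense block + far coercivity + Schur complement, FORMATC-DESIGN §1)
establishes from closed forms for `G`. -/
theorem weilPositivityOn_of_gram_nonneg (ha : 0 < a)
    (h : ∀ (N : ℕ) (c : ℤ → ℂ),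
      0 ≤ (∑ m ∈ modes N, ∑ n ∈ modes N, c m * conj (c n) * weilWindowSesq a (chi a m) (chi a n)).re) :
    WeilPositivityOn a := by
  refine weilPositivityOn_of_weilWindowForm_sum_chi_nonneg ha fun N c ↦ ?_
  rw [weilWindowForm_sum_smul_eq_re ha.le (modes N) (fun n _ ↦ isWindowFunction_chi ha n) c a]
  exact h N c

/-- Sector version: non-negativity of the Gram hermitian form on EVEN and on ODD coefficient vectors
suffices (`a > 0`; `WeilFormatCWindowSectors.lean`). -/
theorem weilPositivityOn_of_gram_sector_nonneg (ha : 0 < a)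
    (hev : ∀ (N : ℕ) (c : ℤ → ℂ), (∀ n, c (-n) = c n) →
      0 ≤ (∑ m ∈ modes N, ∑ n ∈ modes N, c m * conj (c n) * weilWindowSesq a (chi a m) (chi a n)).re)
    (hod : ∀ (N : ℕ) (c : ℤ → ℂ), (∀ n, c (-n) = -c n) →
      0 ≤ (∑ m ∈ modes N, ∑ n ∈ modes N, c m * conj (c n) * weilWindowSesq a (chi a m) (chi a n)).re) :
    WeilPositivityOn a := by
  refine weilPositivityOn_of_sector_nonneg ha (fun N c hc ↦ ?_) (fun N c hc ↦ ?_)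
  · rw [weilWindowForm_sum_smul_eq_re ha.le (modes N) (fun n _ ↦ isWindowFunction_chi ha n) c a]
    exact hev N c hc
  · rw [weilWindowForm_sum_smul_eq_re ha.le (modes N) (fun n _ ↦ isWindowFunction_chi ha n) c a]
    exact hod N c hc

/-! ## Real Gram matrices: real positive semidefiniteness suffices -/

/-- For a matrix with REAL entries the hermitian form on a complex vector is the sum of the real
quadratic forms on its real and imaginary parts:
`Re Σ_{i,j} c_i conj(c_j) G_{ij} = Σ_{i,j} (Re c_i)(Re c_j) Re G_{ij} + Σ_{i,j} (Im c_i)(Im c_j) Re G_{ij}`. -/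
theorem re_sum_sum_mul_conj_mul_eq {ι : Type*} (s : Finset ι) {G : ι → ι → ℂ}
    (hreal : ∀ i ∈ s, ∀ j ∈ s, (G i j).im = 0) (c : ι → ℂ) :
    (∑ i ∈ s, ∑ j ∈ s, c i * conj (c j) * G i j).re =
      (∑ i ∈ s, ∑ j ∈ s, (c i).re * (c j).re * (G i j).re) +
        ∑ i ∈ s, ∑ j ∈ s, (c i).im * (c j).im * (G i j).re := by
  rw [Complex.re_sum, ← Finset.sum_add_distrib]
  refine Finset.sum_congr rfl fun i hi ↦ ?_
  rw [Complex.re_sum, ← Finset.sum_add_distrib]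
  refine Finset.sum_congr rfl fun j hj ↦ ?_
  have h := hreal i hi j hj
  simp only [Complex.mul_re, Complex.mul_im, Complex.conj_re, Complex.conj_im, h]
  ring

/-- **Real PSD certificates suffice.** If the Gram matrix `G` has real entries on `s × s` and its real
quadratic form is non-negative on every real vector satisfying a property `P` that is inherited by
real and imaginary parts, then `Re Σ c_i conj(c_j) G_{ij} ≥ 0` for every complex vector with `P`-real
and `P`-imaginary parts. (Used with `P = ⊤`, `P = even`, `P = odd`.) -/
theorem re_sum_sum_mul_conj_mul_nonneg {ι : Type*} (s : Finset ι) {G : ι → ι → ℂ}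
    (hreal : ∀ i ∈ s, ∀ j ∈ s, (G i j).im = 0) (P : (ι → ℝ) → Prop)
    (hpsd : ∀ x : ι → ℝ, P x → 0 ≤ ∑ i ∈ s, ∑ j ∈ s, x i * x j * (G i j).re)
    (c : ι → ℂ) (hre : P (fun i ↦ (c i).re)) (him : P (fun i ↦ (c i).im)) :
    0 ≤ (∑ i ∈ s, ∑ j ∈ s, c i * conj (c j) * G i j).re := by
  rw [re_sum_sum_mul_conj_mul_eq s hreal c]
  exact add_nonneg (hpsd _ hre) (hpsd _ him)

/-- **From a REAL Gram certificate to a rung.** Let `a > 0` and `G(m,n) = weilWindowSesq a χ_m χ_n`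
have real entries. If `Σ_{m,n} x_m x_n Re G(m,n) ≥ 0` for every `N` and every REAL vector
`x : ℤ → ℝ` (e.g. by an exact `LDLᵀ` / interval PSD certificate of the real symmetric matrix), then
`WeilPositivityOn a`. -/
theorem weilPositivityOn_of_real_gram_psd (ha : 0 < a)
    (hreal : ∀ m n : ℤ, (weilWindowSesq a (chi a m) (chi a n)).im = 0)
    (hpsd : ∀ (N : ℕ) (x : ℤ → ℝ),
      0 ≤ ∑ m ∈ modes N, ∑ n ∈ modes N, x m * x n * (weilWindowSesq a (chi a m) (chi a n)).re) :
    WeilPositivityOn a :=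
  weilPositivityOn_of_gram_nonneg ha fun N c ↦
    re_sum_sum_mul_conj_mul_nonneg (modes N) (fun m _ n _ ↦ hreal m n) (fun _ ↦ True)
      (fun x _ ↦ hpsd N x) c trivial trivial

/-- **From REAL SECTOR Gram certificates to a rung.** As `weilPositivityOn_of_real_gram_psd`, but it
suffices to certify the real quadratic form on EVEN real vectors (`x_{-n} = x_n`) and on ODD real
vectors (`x_{-n} = −x_n`) separately — the shape of the per-parity format-C certificates. -/
theorem weilPositivityOn_of_real_gram_sector_psd (ha : 0 < a)
    (hreal : ∀ m n : ℤ, (weilWindowSesq a (chi a m) (chi a n)).im = 0)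
    (hev : ∀ (N : ℕ) (x : ℤ → ℝ), (∀ n, x (-n) = x n) →
      0 ≤ ∑ m ∈ modes N, ∑ n ∈ modes N, x m * x n * (weilWindowSesq a (chi a m) (chi a n)).re)
    (hod : ∀ (N : ℕ) (x : ℤ → ℝ), (∀ n, x (-n) = -x n) →
      0 ≤ ∑ m ∈ modes N, ∑ n ∈ modes N, x m * x n * (weilWindowSesq a (chi a m) (chi a n)).re) :
    WeilPositivityOn a := by
  refine weilPositivityOn_of_gram_sector_nonneg ha (fun N c hc ↦ ?_) (fun N c hc ↦ ?_)
  · exact re_sum_sum_mul_conj_mul_nonneg (modes N) (fun m _ n _ ↦ hreal m n)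
      (fun x ↦ ∀ n, x (-n) = x n) (fun x hx ↦ hev N x hx) c
      (fun n ↦ by simp only [hc n]) (fun n ↦ by simp only [hc n])
  · exact re_sum_sum_mul_conj_mul_nonneg (modes N) (fun m _ n _ ↦ hreal m n)
      (fun x ↦ ∀ n, x (-n) = -x n) (fun x hx ↦ hod N x hx) c
      (fun n ↦ by simp only [hc n, Complex.neg_re]) (fun n ↦ by simp only [hc n, Complex.neg_im])

end Summit.RiemannHypothesis.RiemannHypothesis.Theorems.WeilFormatC

end
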